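import Summits.CriticalPhenomena.SAWScalingLimit.Theorems.MassRatio.Negative.Tools

/-!
# Crux `MassRatio` (stmt-CriticalPhenomena-8550) — load-bearing hypotheses: named frame pieces and the parametrised crux `MassRatioAt c σ τ`

Negative-series file (refuter, cdisprove, cycle 4). Named pieces of the crux's hypothesis frame — `Flat`, `Frame`,
`FrameNoRows`, `Exhausts`, `ALim`, `BLim`, `Conclusion c σ τ` — the parametrised statement `MassRatioAt c σ τ`
with **`massRatio_iff_at : MassRatio ↔ MassRatioAt (3/4) 0 0`** (the crux is literally the instance `c = 3/4`,
`σ = τ = 0`), the four hypothesis-dropped variants `MassRatioAtWithoutRows/RhoPos/BLimit/Exhaustion c σ τ`, and the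
bookkeeping `massRatioAt_of_without` (each variant is a strengthening). Their refutations at every cut are in
`AnyCutB.lean`; the `Preconnected` analysis in `Decoration.lean` ff.
-/

namespace Summit.CriticalPhenomena.SAWScalingLimit.Theorems.MassRatio.Negative

open Literature.Probability.LatticeModels Literature.Probability.RandomPlanarGeometry.SAW
open Literature.Probability.RandomPlanarGeometry
open Summit.CriticalPhenomena.SAWScalingLimit.Theses.SAWDefectDecoherence

/-- flatness of `D` at `b = D.pt 1` in the `ρ`-ball [folklore] -/
def Flat (D : DobrushinDomain) (ρ : ℝ) : Prop :=
  D.carrier ∩ Metric.ball (D.pt 1) ρ = {z : ℂ | (D.pt 1).im < z.im} ∩ Metric.ball (D.pt 1) ρ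

/-- the admissibility frame of the crux: simply connected, boundary mid-edges, a SAW, connected,
inside, rows clause in the `ρ`-ball (eventually) [folklore] -/
def Frame (D : DobrushinDomain) (ρ : ℝ) (Λ : ℝ → Finset HexVertex) (m : ℝ → ℤ)
    (a b : ℝ → Sym2 HexVertex) : Prop :=
  ∀ᶠ δ : ℝ in nhdsWithin 0 (Set.Ioi 0), hexDomainSimplyConnected (Λ δ) ∧
    a δ ∈ hexDomainBoundary (Λ δ) ∧ b δ ∈ hexDomainBoundary (Λ δ) ∧
    Nonempty (HexMidEdgeSAW (Λ δ) (a δ) (b δ)) ∧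
    (hexGraph.induce ((Λ δ : Finset HexVertex) : Set HexVertex)).Preconnected ∧
    (∀ v ∈ Λ δ, (δ : ℂ) * hexCenter v ∈ D.carrier) ∧
    (∀ v : HexVertex, (δ : ℂ) * hexCenter v ∈ Metric.ball (D.pt 1) ρ → (v ∈ Λ δ ↔ m δ ≤ v.1 1))

/-- the frame with the rows clause deleted [folklore] -/
def FrameNoRows (D : DobrushinDomain) (Λ : ℝ → Finset HexVertex) (a b : ℝ → Sym2 HexVertex) : Prop :=
  ∀ᶠ δ : ℝ in nhdsWithin 0 (Set.Ioi 0), hexDomainSimplyConnected (Λ δ) ∧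
    a δ ∈ hexDomainBoundary (Λ δ) ∧ b δ ∈ hexDomainBoundary (Λ δ) ∧
    Nonempty (HexMidEdgeSAW (Λ δ) (a δ) (b δ)) ∧
    (hexGraph.induce ((Λ δ : Finset HexVertex) : Set HexVertex)).Preconnected ∧
    (∀ v ∈ Λ δ, (δ : ℂ) * hexCenter v ∈ D.carrier)

/-- exhaustion of the compacts of `D` [folklore] -/
def Exhausts (D : DobrushinDomain) (Λ : ℝ → Finset HexVertex) : Prop :=
  ∀ K : Set ℂ, IsCompact K → K ⊆ D.carrier → ∀ᶠ δ : ℝ in nhdsWithin 0 (Set.Ioi 0),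
    ∀ v : HexVertex, (δ : ℂ) * hexCenter v ∈ K → v ∈ Λ δ

/-- `δ·mid(a_δ) → a` [folklore] -/
def ALim (D : DobrushinDomain) (a : ℝ → Sym2 HexVertex) : Prop :=
  Filter.Tendsto (fun δ : ℝ => (δ : ℂ) * hexMidpoint (a δ)) (nhdsWithin 0 (Set.Ioi 0)) (nhds (D.pt 0))

/-- `δ·mid(b_δ) → b` [folklore] -/
def BLim (D : DobrushinDomain) (b : ℝ → Sym2 HexVertex) : Prop :=
  Filter.Tendsto (fun δ : ℝ => (δ : ℂ) * hexMidpoint (b δ)) (nhdsWithin 0 (Set.Ioi 0)) (nhds (D.pt 1))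

/-- the conclusion at cut `c`, bulk spin `σ`, normalising spin `τ`:
`∀ K ⋐ D ∃ C, δ² Σ_{mid e ∈ K} |F_σ(e)| ≤ C δ^{-c} |F_τ(b_δ)|` eventually [folklore] -/
def Conclusion (c σ τ : ℝ) (D : DobrushinDomain) (Λ : ℝ → Finset HexVertex)
    (a b : ℝ → Sym2 HexVertex) : Prop :=
  ∀ K : Set ℂ, IsCompact K → K ⊆ D.carrier → ∃ C : ℝ, ∀ᶠ δ : ℝ in nhdsWithin 0 (Set.Ioi 0),
    δ ^ 2 * (∑ᶠ e ∈ {e : Sym2 HexVertex | e ∈ hexDomainMidEdges (Λ δ) ∧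
      (δ : ℂ) * hexMidpoint e ∈ K}, ‖hexParafermionicObservable (Λ δ) (a δ) hexCriticalFugacity σ e‖) ≤
      C * δ ^ (-c) * ‖hexParafermionicObservable (Λ δ) (a δ) hexCriticalFugacity τ (b δ)‖

/-- **The crux at cut `c`** (bulk spin `σ`, normalising spin `τ`; the crux is `c = 3/4`, `σ = τ = 0`). [folklore] -/
def MassRatioAt (c σ τ : ℝ) : Prop :=
  ∀ (D : DobrushinDomain) (ρ : ℝ) (Λ : ℝ → Finset HexVertex) (m : ℝ → ℤ) (a b : ℝ → Sym2 HexVertex),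
    0 < ρ → Flat D ρ → Frame D ρ Λ m a b → Exhausts D Λ → ALim D a → BLim D b → Conclusion c σ τ D Λ a b

/-- `MassRatio` is literally `MassRatioAt (3/4) 0 0`. [folklore] -/
theorem massRatio_iff_at : MassRatio ↔ MassRatioAt (3 / 4) 0 0 := by
  have h : ∀ δ : ℝ, δ ^ (-(3 : ℝ) / 4) = δ ^ (-(3 / 4 : ℝ)) := fun δ => by norm_num
  simp only [MassRatio, MassRatioAt, Flat, Frame, Exhausts, ALim, BLim, Conclusion, h]

/-- variant: rows clause (and its binder `m`) deleted [folklore] -/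
def MassRatioAtWithoutRows (c σ τ : ℝ) : Prop :=
  ∀ (D : DobrushinDomain) (ρ : ℝ) (Λ : ℝ → Finset HexVertex) (a b : ℝ → Sym2 HexVertex),
    0 < ρ → Flat D ρ → FrameNoRows D Λ a b → Exhausts D Λ → ALim D a → BLim D b →
      Conclusion c σ τ D Λ a b

/-- variant: `0 < ρ` deleted [folklore] -/
def MassRatioAtWithoutRhoPos (c σ τ : ℝ) : Prop :=
  ∀ (D : DobrushinDomain) (ρ : ℝ) (Λ : ℝ → Finset HexVertex) (m : ℝ → ℤ) (a b : ℝ → Sym2 HexVertex),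
    Flat D ρ → Frame D ρ Λ m a b → Exhausts D Λ → ALim D a → BLim D b → Conclusion c σ τ D Λ a b

/-- variant: `δ·mid(b_δ) → b` deleted [folklore] -/
def MassRatioAtWithoutBLimit (c σ τ : ℝ) : Prop :=
  ∀ (D : DobrushinDomain) (ρ : ℝ) (Λ : ℝ → Finset HexVertex) (m : ℝ → ℤ) (a b : ℝ → Sym2 HexVertex),
    0 < ρ → Flat D ρ → Frame D ρ Λ m a b → Exhausts D Λ → ALim D a → Conclusion c σ τ D Λ a b

/-- variant: exhaustion deleted [folklore] -/
def MassRatioAtWithoutExhaustion (c σ τ : ℝ) : Prop :=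
  ∀ (D : DobrushinDomain) (ρ : ℝ) (Λ : ℝ → Finset HexVertex) (m : ℝ → ℤ) (a b : ℝ → Sym2 HexVertex),
    0 < ρ → Flat D ρ → Frame D ρ Λ m a b → ALim D a → BLim D b → Conclusion c σ τ D Λ a b

/-- Each variant implies the cut-`c` crux with the corresponding hypothesis restored (they are
strengthenings); recorded as the contrapositive of interest: a refutation of `MassRatioAt c σ τ`
itself would follow from NONE of the four theorems below. [folklore] -/
theorem massRatioAt_of_without (c σ τ : ℝ) :
    (MassRatioAtWithoutRows c σ τ → MassRatioAt c σ τ) ∧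
    (MassRatioAtWithoutRhoPos c σ τ → MassRatioAt c σ τ) ∧
    (MassRatioAtWithoutBLimit c σ τ → MassRatioAt c σ τ) ∧
    (MassRatioAtWithoutExhaustion c σ τ → MassRatioAt c σ τ) := by
  refine ⟨fun h D ρ Λ m a b hρ hf hfr hex ha hb => h D ρ Λ a b hρ hf (hfr.mono fun δ hδ =>
      ⟨hδ.1, hδ.2.1, hδ.2.2.1, hδ.2.2.2.1, hδ.2.2.2.2.1, hδ.2.2.2.2.2.1⟩) hex ha hb,
    fun h D ρ Λ m a b _ hf hfr hex ha hb => h D ρ Λ m a b hf hfr hex ha hb,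
    fun h D ρ Λ m a b hρ hf hfr hex ha _ => h D ρ Λ m a b hρ hf hfr hex ha,
    fun h D ρ Λ m a b hρ hf hfr _ ha hb => h D ρ Λ m a b hρ hf hfr ha hb⟩


end Summit.CriticalPhenomena.SAWScalingLimit.Theorems.MassRatio.Negative
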